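/-
Literature anchor (engines lane eng-sdp-1, idle-priority Lean literature lane).
Source: V. Berinde, *Iterative Approximation of Fixed Points*, Lecture Notes in Mathematics 1912,
Springer 2007, Chapter 7 §7.1 (stability of fixed point iteration procedures: Definition 7.1,
condition (4), Theorems 7.1 and 7.2), §7.2 (approximate sequences and weak stability:
Definitions 7.3, 7.4, Remark 1), Example 7.2) and Chapter 1 Lemma 1.6 (i).  [cite: Berinde2007]
-/
import Mathlib
import HarnessLib
import Literature.Analysis.Convex.AlmostContractions

/-!
# Stability of fixed point iteration procedures (Berinde 2007, Ch. 7 §7.1–§7.2)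

A fixed point iteration procedure `x_{n+1} = f(T, x_n)` ((1); the `n`-th step may carry its own
parameters, so we model it as `F : ℕ → X → X`, `x_{n+1} = F n x_n`) is **`T`-stable** at the fixed
point `p` (Harder–Hicks; Definition 7.1) if for every sequence `(y_n)` in `X`, with
`ε_n = d(y_{n+1}, F n y_n)` ((2)),

  `ε_n → 0  ⟺  y_n → p`   ((3)).

Main results formalised:

* `tendsto_zero_of_succ_le_mul_add` — **Lemma 1.6 (i)**: `0 ≤ a_{n+1} ≤ q a_n + b_n`, `0 ≤ q < 1`,
  `b_n → 0` ⟹ `a_n → 0`;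
* `picard_isTStable` — **Theorem 7.1**: in a metric space, if `T` satisfies (4)
  `d(Tx, Ty) ≤ a d(x, y) + L d(x, Tx)` (`a ∈ [0,1)`, `L ≥ 0`; this is the tree's
  `AlmostContractions.BerindeUniquenessCondition T a L`, condition (42) of Ch. 2) and has a fixed
  point `x*`, then the Picard iteration converges to `x*` (`tendsto_picard_of_cond4`, by name from
  `BerindeUniquenessCondition.tendsto_iterate_fixedPoint`) and is `T`-stable;
* `ishikawa_isTStable` — **Theorem 7.2**: in a normed space, under (4), the Ishikawa iteration
  `x_{n+1} = (1 − α_n) x_n + α_n T((1 − β_n) x_n + β_n T x_n)` with `α_n, β_n ∈ [0,1]`,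
  `0 < α ≤ α_n`, converges to `x*` (`tendsto_ishikawa_of_cond4`) and is `T`-stable, via the estimate
  `‖y_{n+1} − x*‖ ≤ [1 − α(1 − a)] ‖y_n − x*‖ + ε_n` (`norm_succ_sub_le_of_cond4`);
* `IsApproximateSeq`, `IsWeaklyTStable`, `IsTStable.isWeaklyTStable` — Definitions 7.3, 7.4 and
  Remark 1) of §7.2 (stable ⟹ weakly stable);
* `example72_not_isWeaklyTStable`, `example72_not_isTStable` — **Example 7.2**: for
  `T x = 1/2 (x ≤ 1/2), T x = 0 (x > 1/2)` the Picard iteration (constant `1/2` from the second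
  step on) is not weakly `T`-stable, hence not `T`-stable (explicit approximate sequence
  `y_{2m} = 1/2 + 1/(2m+2)`, `y_{2m+1} = 0`);
* `example73_not_isTStable` — the map of **Example 7.3**, `T x = 0 (x ≤ 1/2), T x = 1/2 (x > 1/2)`:
  the Picard iteration converges to `0` but is not `T`-stable ("as known, the Picard iteration is
  not T-stable"; witness `y_n = 1/2 + 1/(n+2)`);
* `neg_not_isTStable` — Remark 3) of §7.1 in its simplest instance: for the nonexpansive map
  `T x = −x` of `ℝ` (unique fixed point `0`) the Picard iteration is not `T`-stable
  (`y_n = (−1)^n` has `ε_n = 0`).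

Conventions / declared deviations: indices from `0`; Definition 7.1 is stated as the bare
equivalence (3) for all sequences `y` (the convergence of the unperturbed iteration, presupposed in
the book, is proved separately in Theorems 7.1/7.2); the maps of Examples 7.2/7.3 are extended to all
of `ℝ` by the same formulas; Lemma 1.6 (ii) (summable version) is not needed here and not included.
-/

namespace Literature.Analysis.Convex.IterationStability

open Filter Topology Set Function
open Literature.Analysis.Convex.AlmostContractions

/-! ## Lemma 1.6 (i) -/

/-- **Lemma 1.6 (i).** If `a_n, b_n ≥ 0`, `0 ≤ q < 1`, `a_{n+1} ≤ q a_n + b_n` for all `n` and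
`b_n → 0`, then `a_n → 0`. [cite: Berinde2007, Ch. 1 §1.3, Lemma 1.6 (i)] -/
theorem tendsto_zero_of_succ_le_mul_add {a b : ℕ → ℝ} {q : ℝ} (ha : ∀ n, 0 ≤ a n) (hq0 : 0 ≤ q)
    (hq1 : q < 1) (h : ∀ n, a (n + 1) ≤ q * a n + b n) (hb : Tendsto b atTop (𝓝 0)) :
    Tendsto a atTop (𝓝 0) := by
  rw [Metric.tendsto_atTop]
  intro ε hε
  have hε' : 0 < ε * (1 - q) / 2 := by
    have : 0 < 1 - q := sub_pos.2 hq1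
    positivity
  obtain ⟨N, hN⟩ := Metric.tendsto_atTop.1 hb _ hε'
  -- `a (N + m) ≤ q^m a N + ε/2`
  have key : ∀ m, a (N + m) ≤ q ^ m * a N + ε / 2 := by
    intro m
    induction m with
    | zero => simp; linarith
    | succ m ih =>
      have hbm : b (N + m) ≤ ε * (1 - q) / 2 := by
        have := hN (N + m) (Nat.le_add_right N m)
        rw [Real.dist_0_eq_abs] at this
        exact (le_abs_self _).trans this.le
      calc a (N + (m + 1)) = a (N + m + 1) := by rw [Nat.add_assoc]
        _ ≤ q * a (N + m) + b (N + m) := h (N + m)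
        _ ≤ q * (q ^ m * a N + ε / 2) + ε * (1 - q) / 2 := by
            gcongr
        _ = q ^ (m + 1) * a N + ε / 2 + (-(ε * (1 - q) / 2) * 0 + 0) := by ring
        _ = q ^ (m + 1) * a N + ε / 2 := by ring
  -- `q^m a N → 0`
  have hpow : Tendsto (fun m => q ^ m * a N) atTop (𝓝 0) := by
    rw [← zero_mul (a N)]
    exact (tendsto_pow_atTop_nhds_zero_of_lt_one hq0 hq1).mul tendsto_const_nhds
  obtain ⟨M, hM⟩ := Metric.tendsto_atTop.1 hpow (ε / 2) (by positivity)
  refine ⟨N + M, fun n hn => ?_⟩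
  obtain ⟨m, rfl⟩ : ∃ m, n = N + m := ⟨n - N, by omega⟩
  have hm : M ≤ m := by omega
  have h1 := hM m hm
  rw [Real.dist_0_eq_abs, abs_lt] at h1
  rw [Real.dist_0_eq_abs, abs_of_nonneg (ha _)]
  linarith [key m, h1.2]

/-! ## Definition 7.1: `T`-stability of an iteration procedure -/

variable {X : Type*} [MetricSpace X]

/-- **Definition 7.1 (Harder–Hicks).** The iteration procedure `x_{n+1} = F n x_n` (`F n = f(T, ·)`
with the parameters of the `n`-th step) is `T`-**stable** at `p` if for every sequence `y` in `X`,
`ε_n = d(y_{n+1}, F n y_n) → 0 ⟺ y_n → p`. [cite: Berinde2007, Ch. 7 §7.1, Def. 7.1 (2)–(3)] -/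
def IsTStable (F : ℕ → X → X) (p : X) : Prop :=
  ∀ y : ℕ → X, Tendsto (fun n => dist (y (n + 1)) (F n (y n))) atTop (𝓝 0) ↔ Tendsto y atTop (𝓝 p)

/-! ## Theorem 7.1: the Picard iteration under condition (4) -/

section Picard

variable {T : X → X} {a L : ℝ} {p : X}

/-- Condition (4) `d(Tx, Ty) ≤ a d(x, y) + L d(x, Tx)` with `x := x*` a fixed point gives
`d(T y, x*) ≤ a d(y, x*)`. [cite: Berinde2007, Ch. 7 §7.1, Thm. 7.1 (proof)] -/
theorem dist_apply_fixedPoint_le_of_cond4 (h4 : BerindeUniquenessCondition T a L) (hp : T p = p)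
    (y : X) : dist (T y) p ≤ a * dist y p := by
  have h1 := h4.dist_le p y
  rw [hp, dist_self, mul_zero, add_zero, dist_comm p (T y), dist_comm p y] at h1
  exact h1

/-- (5): `d(y_{n+1}, x*) ≤ a d(y_n, x*) + ε_n` for every sequence `y`, `ε_n = d(y_{n+1}, T y_n)`.
[cite: Berinde2007, Ch. 7 §7.1, Thm. 7.1 (5)] -/
theorem dist_succ_fixedPoint_le_of_cond4 (h4 : BerindeUniquenessCondition T a L) (hp : T p = p)
    (y : ℕ → X) (n : ℕ) :
    dist (y (n + 1)) p ≤ a * dist (y n) p + dist (y (n + 1)) (T (y n)) := by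
  calc dist (y (n + 1)) p ≤ dist (y (n + 1)) (T (y n)) + dist (T (y n)) p := dist_triangle _ _ _
    _ ≤ dist (y (n + 1)) (T (y n)) + a * dist (y n) p := by
        gcongr; exact dist_apply_fixedPoint_le_of_cond4 h4 hp _
    _ = _ := by ring

/-- **Theorem 7.1, convergence part**: under (4) with a fixed point `x*`, the Picard iteration
`x_{n+1} = T x_n` converges to `x*` (the tree's Theorem 2.12 (2)).
[cite: Berinde2007, Ch. 7 §7.1, Thm. 7.1] -/
theorem tendsto_picard_of_cond4 (h4 : BerindeUniquenessCondition T a L) (hp : T p = p) (x₀ : X) :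
    Tendsto (fun n => T^[n] x₀) atTop (𝓝 p) :=
  h4.tendsto_iterate_fixedPoint hp x₀

/-- **Theorem 7.1 (Harder–Hicks / Osilike / Berinde), stability part.** In a metric space, if `T`
satisfies (4) `d(Tx, Ty) ≤ a d(x, y) + L d(x, Tx)` (`0 ≤ a < 1`, `L ≥ 0`) and `T x* = x*`, then
the Picard iteration is `T`-stable: for every sequence `y`, `d(y_{n+1}, T y_n) → 0 ⟺ y_n → x*`.
[cite: Berinde2007, Ch. 7 §7.1, Thm. 7.1] -/
theorem picard_isTStable (h4 : BerindeUniquenessCondition T a L) (hp : T p = p) :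
    IsTStable (fun _ => T) p := by
  intro y
  constructor
  · intro hε
    rw [tendsto_iff_dist_tendsto_zero]
    exact tendsto_zero_of_succ_le_mul_add (fun n => dist_nonneg) h4.nonneg h4.lt_one
      (fun n => dist_succ_fixedPoint_le_of_cond4 h4 hp y n) hε
  · intro hy
    have hy' := (tendsto_iff_dist_tendsto_zero.1 hy)
    -- `ε_n ≤ d(y_{n+1}, x*) + a d(y_n, x*)`
    have hle : ∀ n, dist (y (n + 1)) (T (y n)) ≤ dist (y (n + 1)) p + a * dist (y n) p := fun n =>
      calc dist (y (n + 1)) (T (y n)) ≤ dist (y (n + 1)) p + dist p (T (y n)) := dist_triangle _ _ _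
        _ ≤ dist (y (n + 1)) p + a * dist (y n) p := by
            rw [dist_comm p]; gcongr; exact dist_apply_fixedPoint_le_of_cond4 h4 hp _
    have hlim : Tendsto (fun n => dist (y (n + 1)) p + a * dist (y n) p) atTop (𝓝 0) := by
      rw [show (0 : ℝ) = 0 + a * 0 by ring]
      exact ((tendsto_add_atTop_iff_nat 1).2 hy').add (hy'.const_mul a)
    exact tendsto_of_tendsto_of_tendsto_of_le_of_le tendsto_const_nhds hlim
      (fun n => dist_nonneg) hle

end Picard

/-! ## Theorem 7.2: the Ishikawa iteration under condition (4) in a normed space -/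

section Ishikawa

variable {E : Type*} [NormedAddCommGroup E] [NormedSpace ℝ E]
variable {T : E → E} {a L al : ℝ} {p : E} {α β : ℕ → ℝ}

/-- The Ishikawa step `y ↦ (1 − a) y + a T((1 − b) y + b T y)` of Theorem 7.2 (the tree's
`IshikawaIteration.ishikawaStep`, written out). [cite: Berinde2007, Ch. 7 §7.1, Thm. 7.2] -/
def ishStep (T : E → E) (a b : ℝ) (y : E) : E := (1 - a) • y + a • T ((1 - b) • y + b • T y)

/-- The estimate of the proof of Theorem 7.2: under (4), for `α_n, β_n ∈ [0,1]`,
`‖F_n y − x*‖ ≤ [1 − α_n (1 − a)] ‖y − x*‖` where `F_n` is the Ishikawa step.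
[cite: Berinde2007, Ch. 7 §7.1, Thm. 7.2 (proof)] -/
theorem norm_ishStep_sub_le_of_cond4 (h4 : BerindeUniquenessCondition T a L) (hp : T p = p)
    {c d : ℝ} (hc0 : 0 ≤ c) (hc1 : c ≤ 1) (hd0 : 0 ≤ d) (hd1 : d ≤ 1) (y : E) :
    ‖ishStep T c d y - p‖ ≤ (1 - c * (1 - a)) * ‖y - p‖ := by
  have hT : ∀ z : E, ‖T z - p‖ ≤ a * ‖z - p‖ := by
    intro z
    have := dist_apply_fixedPoint_le_of_cond4 h4 hp z
    rwa [dist_eq_norm, dist_eq_norm] at this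
  set s := (1 - d) • y + d • T y with hs
  have h1 : ‖s - p‖ ≤ ((1 - d) + d * a) * ‖y - p‖ := by
    have e : s - p = (1 - d) • (y - p) + d • (T y - p) := by rw [hs]; module
    calc ‖s - p‖ = ‖(1 - d) • (y - p) + d • (T y - p)‖ := by rw [e]
      _ ≤ ‖(1 - d) • (y - p)‖ + ‖d • (T y - p)‖ := norm_add_le _ _
      _ = (1 - d) * ‖y - p‖ + d * ‖T y - p‖ := by
          rw [norm_smul, norm_smul, Real.norm_eq_abs, Real.norm_eq_abs, abs_of_nonneg hd0,
            abs_of_nonneg (sub_nonneg.2 hd1)]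
      _ ≤ (1 - d) * ‖y - p‖ + d * (a * ‖y - p‖) := by gcongr; exact hT y
      _ = _ := by ring
  have h2 : ‖s - p‖ ≤ ‖y - p‖ := by
    have : ((1 - d) + d * a) ≤ 1 := by nlinarith [h4.lt_one]
    exact h1.trans (mul_le_of_le_one_left (norm_nonneg _) this)
  have e2 : ishStep T c d y - p = (1 - c) • (y - p) + c • (T s - p) := by
    simp only [ishStep, ← hs]; module
  calc ‖ishStep T c d y - p‖ = ‖(1 - c) • (y - p) + c • (T s - p)‖ := by rw [e2]
    _ ≤ ‖(1 - c) • (y - p)‖ + ‖c • (T s - p)‖ := norm_add_le _ _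
    _ = (1 - c) * ‖y - p‖ + c * ‖T s - p‖ := by
        rw [norm_smul, norm_smul, Real.norm_eq_abs, Real.norm_eq_abs, abs_of_nonneg hc0,
          abs_of_nonneg (sub_nonneg.2 hc1)]
    _ ≤ (1 - c) * ‖y - p‖ + c * (a * ‖y - p‖) := by
        gcongr
        exact (hT s).trans (mul_le_mul_of_nonneg_left h2 h4.nonneg)
    _ = (1 - c * (1 - a)) * ‖y - p‖ := by ring

/-- For every sequence `y`: `‖y_{n+1} − x*‖ ≤ [1 − α(1 − a)] ‖y_n − x*‖ + ε_n`, where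
`ε_n = ‖y_{n+1} − F_n y_n‖` and `0 < α ≤ α_n ≤ 1`, `β_n ∈ [0,1]`.
[cite: Berinde2007, Ch. 7 §7.1, Thm. 7.2 (proof)] -/
theorem norm_succ_sub_le_of_cond4 (h4 : BerindeUniquenessCondition T a L) (hp : T p = p)
    (hα : ∀ n, al ≤ α n ∧ α n ≤ 1) (hal : 0 < al) (hβ : ∀ n, 0 ≤ β n ∧ β n ≤ 1)
    (y : ℕ → E) (n : ℕ) :
    ‖y (n + 1) - p‖ ≤ (1 - al * (1 - a)) * ‖y n - p‖
      + ‖y (n + 1) - ishStep T (α n) (β n) (y n)‖ := by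
  have h1 := norm_ishStep_sub_le_of_cond4 h4 hp (hal.le.trans (hα n).1) (hα n).2 (hβ n).1
    (hβ n).2 (y n)
  have h2 : (1 - α n * (1 - a)) * ‖y n - p‖ ≤ (1 - al * (1 - a)) * ‖y n - p‖ := by
    apply mul_le_mul_of_nonneg_right _ (norm_nonneg _)
    nlinarith [(hα n).1, h4.lt_one]
  calc ‖y (n + 1) - p‖ = ‖(y (n + 1) - ishStep T (α n) (β n) (y n)) + (ishStep T (α n) (β n) (y n) - p)‖ := by
        rw [sub_add_sub_cancel]
    _ ≤ ‖y (n + 1) - ishStep T (α n) (β n) (y n)‖ + ‖ishStep T (α n) (β n) (y n) - p‖ :=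
        norm_add_le _ _
    _ ≤ _ := by linarith

/-- **Theorem 7.2, convergence part**: under (4), with `0 < α ≤ α_n ≤ 1`, `β_n ∈ [0,1]`, the
Ishikawa iteration `x_{n+1} = (1 − α_n) x_n + α_n T((1 − β_n) x_n + β_n T x_n)` converges to `x*`.
[cite: Berinde2007, Ch. 7 §7.1, Thm. 7.2] -/
theorem tendsto_ishikawa_of_cond4 (h4 : BerindeUniquenessCondition T a L) (hp : T p = p)
    (hα : ∀ n, al ≤ α n ∧ α n ≤ 1) (hal : 0 < al) (hβ : ∀ n, 0 ≤ β n ∧ β n ≤ 1)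
    {x : ℕ → E} (hx : ∀ n, x (n + 1) = ishStep T (α n) (β n) (x n)) :
    Tendsto x atTop (𝓝 p) := by
  rw [tendsto_iff_norm_sub_tendsto_zero]
  have hq1 : 1 - al * (1 - a) < 1 := by nlinarith [h4.lt_one]
  have hq0 : 0 ≤ 1 - al * (1 - a) := by
    have : al ≤ 1 := (hα 0).1.trans (hα 0).2
    nlinarith [h4.nonneg]
  refine tendsto_zero_of_succ_le_mul_add (b := fun _ => 0) (fun n => norm_nonneg _) hq0 hq1
    (fun n => ?_) tendsto_const_nhds
  have := norm_succ_sub_le_of_cond4 h4 hp hα hal hβ x n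
  rw [hx n, sub_self, norm_zero] at this
  rw [hx n]
  exact this

/-- **Theorem 7.2 (stability part).** In a normed space, if `T` satisfies (4) and `T x* = x*`,
then the Ishikawa iteration with `0 < α ≤ α_n ≤ 1`, `β_n ∈ [0,1]` is `T`-stable: for every sequence
`y`, `ε_n = ‖y_{n+1} − (1 − α_n) y_n − α_n T s_n‖ → 0` (`s_n = (1 − β_n) y_n + β_n T y_n`) iff
`y_n → x*`. [cite: Berinde2007, Ch. 7 §7.1, Thm. 7.2] -/
theorem ishikawa_isTStable (h4 : BerindeUniquenessCondition T a L) (hp : T p = p)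
    (hα : ∀ n, al ≤ α n ∧ α n ≤ 1) (hal : 0 < al) (hβ : ∀ n, 0 ≤ β n ∧ β n ≤ 1) :
    IsTStable (fun n => ishStep T (α n) (β n)) p := by
  intro y
  have hq1 : 1 - al * (1 - a) < 1 := by nlinarith [h4.lt_one]
  have hq0 : 0 ≤ 1 - al * (1 - a) := by
    have : al ≤ 1 := (hα 0).1.trans (hα 0).2
    nlinarith [h4.nonneg]
  constructor
  · intro hε
    rw [tendsto_iff_norm_sub_tendsto_zero]
    refine tendsto_zero_of_succ_le_mul_add (fun n => norm_nonneg _) hq0 hq1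
      (fun n => norm_succ_sub_le_of_cond4 h4 hp hα hal hβ y n) ?_
    simpa [dist_eq_norm] using hε
  · intro hy
    -- `ε_n ≤ ‖y_{n+1} − x*‖ + ‖F_n y_n − x*‖ ≤ ‖y_{n+1} − x*‖ + ‖y_n − x*‖`
    have hy' := tendsto_iff_norm_sub_tendsto_zero.1 hy
    have hle : ∀ n, dist (y (n + 1)) (ishStep T (α n) (β n) (y n))
        ≤ ‖y (n + 1) - p‖ + ‖y n - p‖ := by
      intro n
      rw [dist_eq_norm]
      have h1 := norm_ishStep_sub_le_of_cond4 h4 hp (hal.le.trans (hα n).1) (hα n).2 (hβ n).1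
        (hβ n).2 (y n)
      have h2 : (1 - α n * (1 - a)) * ‖y n - p‖ ≤ ‖y n - p‖ := by
        apply mul_le_of_le_one_left (norm_nonneg _)
        nlinarith [(hα n).1, h4.lt_one]
      calc ‖y (n + 1) - ishStep T (α n) (β n) (y n)‖
          = ‖(y (n + 1) - p) - (ishStep T (α n) (β n) (y n) - p)‖ := by rw [sub_sub_sub_cancel_right]
        _ ≤ ‖y (n + 1) - p‖ + ‖ishStep T (α n) (β n) (y n) - p‖ := norm_sub_le _ _
        _ ≤ _ := by linarith
    have hlim : Tendsto (fun n => ‖y (n + 1) - p‖ + ‖y n - p‖) atTop (𝓝 0) := by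
      rw [show (0 : ℝ) = 0 + 0 by ring]
      exact ((tendsto_add_atTop_iff_nat 1).2 hy').add hy'
    exact tendsto_of_tendsto_of_tendsto_of_le_of_le tendsto_const_nhds hlim
      (fun n => dist_nonneg) hle

end Ishikawa

/-! ## §7.2: approximate sequences and weak stability -/

/-- **Definition 7.3.** `y` is an *approximate sequence* of `x`: for every `k` there is `η = η(k)`
with `d(x_n, y_n) ≤ η` for all `n ≥ k`. [cite: Berinde2007, Ch. 7 §7.2, Def. 7.3] -/
def IsApproximateSeq (x y : ℕ → X) : Prop := ∀ k : ℕ, ∃ η : ℝ, ∀ n ≥ k, dist (x n) (y n) ≤ η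

/-- An approximate sequence is exactly one at bounded distance (take `k = 0`).
[cite: Berinde2007, Ch. 7 §7.2, Def. 7.3, Lemma 7.1] -/
theorem isApproximateSeq_iff_bounded {x y : ℕ → X} :
    IsApproximateSeq x y ↔ ∃ η : ℝ, ∀ n, dist (x n) (y n) ≤ η := by
  constructor
  · intro h
    obtain ⟨η, hη⟩ := h 0
    exact ⟨η, fun n => hη n (Nat.zero_le n)⟩
  · rintro ⟨η, hη⟩ k
    exact ⟨η, fun n _ => hη n⟩

/-- **Definition 7.4.** The procedure `x_{n+1} = F n x_n` started at `x 0`, converging to the fixed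
point `p`, is *weakly `T`-stable* if for every approximate sequence `y` of `x`,
`d(y_{n+1}, F n y_n) → 0` implies `y_n → p`. [cite: Berinde2007, Ch. 7 §7.2, Def. 7.4] -/
def IsWeaklyTStable (F : ℕ → X → X) (x : ℕ → X) (p : X) : Prop :=
  (∀ n, x (n + 1) = F n (x n)) ∧ Tendsto x atTop (𝓝 p) ∧
    ∀ y : ℕ → X, IsApproximateSeq x y →
      Tendsto (fun n => dist (y (n + 1)) (F n (y n))) atTop (𝓝 0) → Tendsto y atTop (𝓝 p)

/-- **Remark 1) of §7.2**: a `T`-stable procedure is weakly `T`-stable (along any of its convergent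
orbits). [cite: Berinde2007, Ch. 7 §7.2, Remark 1)] -/
theorem IsTStable.isWeaklyTStable {F : ℕ → X → X} {x : ℕ → X} {p : X} (h : IsTStable F p)
    (hx : ∀ n, x (n + 1) = F n (x n)) (hxp : Tendsto x atTop (𝓝 p)) : IsWeaklyTStable F x p :=
  ⟨hx, hxp, fun y _ hε => (h y).1 hε⟩

/-! ## Examples 7.2, 7.3 and Remark 3) -/

section Examples

/-- The map of Example 7.2: `T x = 1/2` for `x ≤ 1/2`, `T x = 0` for `x > 1/2` (on `[0,1]` in the
book; extended to `ℝ` by the same formula); `F_T = {1/2}`. [cite: Berinde2007, Ch. 7 §7.2, Example 7.2] -/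
noncomputable def ex72Map (x : ℝ) : ℝ := if x ≤ 1 / 2 then 1 / 2 else 0

/-- `T(1/2) = 1/2`. [cite: Berinde2007, Ch. 7 §7.2, Example 7.2] -/
theorem ex72Map_half : ex72Map (1 / 2) = 1 / 2 := by simp [ex72Map]

/-- The Picard iteration of Example 7.2 is constant `1/2` from the second step on: `x_n = 1/2` for
`n ≥ 2`. [cite: Berinde2007, Ch. 7 §7.2, Example 7.2] -/
theorem ex72_iterate (x₀ : ℝ) {n : ℕ} (hn : 2 ≤ n) : ex72Map^[n] x₀ = 1 / 2 := by
  obtain ⟨m, rfl⟩ : ∃ m, n = m + 2 := ⟨n - 2, by omega⟩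
  induction m with
  | zero =>
    simp only [zero_add, Function.iterate_succ, Function.comp_apply]
    unfold ex72Map
    split_ifs <;> norm_num at *
  | succ m ih =>
    rw [show m + 1 + 2 = (m + 2) + 1 by ring, Function.iterate_succ_apply', ih (by omega),
      ex72Map_half]

/-- The Picard iteration of Example 7.2 converges to the fixed point `1/2`.
[cite: Berinde2007, Ch. 7 §7.2, Example 7.2] -/
theorem ex72_tendsto (x₀ : ℝ) : Tendsto (fun n => ex72Map^[n] x₀) atTop (𝓝 (1 / 2)) :=
  tendsto_const_nhds.congr' (eventually_atTop.2 ⟨2, fun _ hn => (ex72_iterate x₀ hn).symm⟩)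

/-- The perturbed sequence used for Example 7.2: `y_{2m} = 1/2 + 1/(2m + 2)`, `y_{2m+1} = 0`.
[cite: Berinde2007, Ch. 7 §7.2, Example 7.2] -/
noncomputable def ex72Seq (n : ℕ) : ℝ := if Even n then 1 / 2 + 1 / ((n : ℝ) + 2) else 0

/-- `ε_n = |y_{n+1} − T y_n| → 0` for the perturbed sequence of Example 7.2 (it equals `0` for even
`n` and `1/(n+3)` for odd `n`). [cite: Berinde2007, Ch. 7 §7.2, Example 7.2] -/
theorem ex72Seq_residual_tendsto :
    Tendsto (fun n => dist (ex72Seq (n + 1)) (ex72Map (ex72Seq n))) atTop (𝓝 0) := by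
  have hb : ∀ n : ℕ, dist (ex72Seq (n + 1)) (ex72Map (ex72Seq n)) ≤ 1 / ((n : ℝ) + 3) := by
    intro n
    rcases Nat.even_or_odd n with he | ho
    · have hne : ¬ Even (n + 1) := Nat.not_even_iff_odd.2 he.add_one
      have hpos : 0 < 1 / ((n : ℝ) + 2) := by positivity
      simp only [ex72Seq, ex72Map, he, hne, if_true, if_false]
      rw [if_neg (by linarith), dist_self]
      positivity
    · have he : Even (n + 1) := ho.add_one
      have hno : ¬ Even n := Nat.not_even_iff_odd.2 ho
      simp only [ex72Seq, ex72Map, he, hno, if_true, if_false]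
      rw [if_pos (by norm_num), Real.dist_eq, Nat.cast_add, Nat.cast_one]
      rw [show (1 : ℝ) / 2 + 1 / ((n : ℝ) + 1 + 2) - 1 / 2 = 1 / ((n : ℝ) + 3) by ring]
      rw [abs_of_pos (by positivity)]
  have hlim : Tendsto (fun n : ℕ => 1 / ((n : ℝ) + 3)) atTop (𝓝 0) := by
    have := tendsto_one_div_add_atTop_nhds_zero_nat (𝕜 := ℝ)
    have h3 := (tendsto_add_atTop_iff_nat 2).2 this
    refine h3.congr (fun n => ?_)
    push_cast; ring
  exact tendsto_of_tendsto_of_tendsto_of_le_of_le tendsto_const_nhds hlim (fun n => dist_nonneg) hb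

/-- The perturbed sequence of Example 7.2 does not converge (its odd terms are `0`, its even terms
exceed `1/2`). [cite: Berinde2007, Ch. 7 §7.2, Example 7.2] -/
theorem ex72Seq_not_tendsto (c : ℝ) : ¬ Tendsto ex72Seq atTop (𝓝 c) := by
  intro h
  have hodd : Tendsto (fun m => ex72Seq (2 * m + 1)) atTop (𝓝 c) :=
    h.comp (tendsto_atTop_mono (fun m : ℕ => (by omega : m ≤ 2 * m + 1)) tendsto_id)
  have hodd' : Tendsto (fun m : ℕ => (0 : ℝ)) atTop (𝓝 c) := by
    refine hodd.congr (fun m => ?_)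
    have : ¬ Even (2 * m + 1) := Nat.not_even_iff_odd.2 (odd_two_mul_add_one m)
    simp [ex72Seq, this]
  have hc : c = 0 := (tendsto_nhds_unique tendsto_const_nhds hodd').symm
  have heven : Tendsto (fun m => ex72Seq (2 * m)) atTop (𝓝 c) :=
    h.comp (tendsto_atTop_mono (fun m : ℕ => (by omega : m ≤ 2 * m)) tendsto_id)
  have hge : ∀ m, (1 / 2 : ℝ) ≤ ex72Seq (2 * m) := by
    intro m
    have : Even (2 * m) := even_two_mul m
    simp only [ex72Seq, this, if_true]
    have : 0 < 1 / ((((2 * m : ℕ)) : ℝ) + 2) := by positivity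
    linarith
  have := ge_of_tendsto' heven hge
  rw [hc] at this
  norm_num at this

/-- **Example 7.2**: the Picard iteration of `T` (from any `x₀`) is **not weakly `T`-stable**: the
perturbed sequence above stays within distance `3/2` of the orbit (an approximate sequence), has
`ε_n → 0`, and diverges. [cite: Berinde2007, Ch. 7 §7.2, Example 7.2] -/
theorem example72_not_isWeaklyTStable (x₀ : ℝ) :
    ¬ IsWeaklyTStable (fun _ => ex72Map) (fun n => ex72Map^[n] x₀) (1 / 2) := by
  rintro ⟨-, -, h⟩
  refine ex72Seq_not_tendsto (1 / 2) (h ex72Seq ?_ ex72Seq_residual_tendsto)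
  -- approximate: from `n ≥ 2` the orbit is `1/2` and `y_n ∈ [0, 1]`
  intro k
  refine ⟨max (dist (ex72Map^[0] x₀) (ex72Seq 0)) (max (dist (ex72Map^[1] x₀) (ex72Seq 1)) 1),
    fun n _ => ?_⟩
  rcases Nat.lt_or_ge n 2 with hn | hn
  · interval_cases n
    · exact le_max_left _ _
    · exact le_max_of_le_right (le_max_left _ _)
  · refine le_max_of_le_right (le_max_of_le_right ?_)
    show dist (ex72Map^[n] x₀) (ex72Seq n) ≤ 1
    rw [ex72_iterate x₀ hn, Real.dist_eq, abs_le]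
    unfold ex72Seq
    split_ifs
    · have : 0 < 1 / ((n : ℝ) + 2) := by positivity
      have : 1 / ((n : ℝ) + 2) ≤ 1 / 2 := by
        have : (2 : ℝ) ≤ n := by exact_mod_cast hn
        exact one_div_le_one_div_of_le two_pos (by linarith)
      constructor <;> linarith
    · constructor <;> norm_num

/-- Hence (Remark 1)) the Picard iteration of Example 7.2 is not `T`-stable either.
[cite: Berinde2007, Ch. 7 §7.2, Example 7.2] -/
theorem example72_not_isTStable : ¬ IsTStable (fun _ => ex72Map) (1 / 2 : ℝ) := fun h =>
  example72_not_isWeaklyTStable 0 (h.isWeaklyTStable (fun _ => Function.iterate_succ_apply' _ _ _)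
    (ex72_tendsto 0))

/-- The map of Example 7.3: `T x = 0` for `x ≤ 1/2`, `T x = 1/2` for `x > 1/2`; `F_T = {0}`.
[cite: Berinde2007, Ch. 7 §7.2, Example 7.3] -/
noncomputable def ex73Map (x : ℝ) : ℝ := if x ≤ 1 / 2 then 0 else 1 / 2

/-- The Picard iteration of Example 7.3 is `0` from the second step on.
[cite: Berinde2007, Ch. 7 §7.2, Example 7.3] -/
theorem ex73_iterate (x₀ : ℝ) {n : ℕ} (hn : 2 ≤ n) : ex73Map^[n] x₀ = 0 := by
  obtain ⟨m, rfl⟩ : ∃ m, n = m + 2 := ⟨n - 2, by omega⟩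
  induction m with
  | zero =>
    simp only [zero_add, Function.iterate_succ, Function.comp_apply]
    unfold ex73Map
    split_ifs <;> norm_num at *
  | succ m ih =>
    rw [show m + 1 + 2 = (m + 2) + 1 by ring, Function.iterate_succ_apply', ih (by omega)]
    simp [ex73Map]

/-- The Picard iteration of Example 7.3 converges to the fixed point `0 = T 0`.
[cite: Berinde2007, Ch. 7 §7.2, Example 7.3] -/
theorem ex73_tendsto (x₀ : ℝ) : Tendsto (fun n => ex73Map^[n] x₀) atTop (𝓝 0) :=
  tendsto_const_nhds.congr' (eventually_atTop.2 ⟨2, fun _ hn => (ex73_iterate x₀ hn).symm⟩)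

/-- **Example 7.3** ("as known, the Picard iteration is not T-stable"): with
`y_n = 1/2 + 1/(n + 2)` one has `T y_n = 1/2`, `ε_n = 1/(n+3) → 0`, but `y_n → 1/2 ≠ 0`.
[cite: Berinde2007, Ch. 7 §7.2, Example 7.3] -/
theorem example73_not_isTStable : ¬ IsTStable (fun _ => ex73Map) (0 : ℝ) := by
  intro h
  set y : ℕ → ℝ := fun n => 1 / 2 + 1 / ((n : ℝ) + 2) with hy
  have hlim0 : Tendsto (fun n : ℕ => 1 / ((n : ℝ) + 2)) atTop (𝓝 0) := by
    have := (tendsto_add_atTop_iff_nat 1).2 (tendsto_one_div_add_atTop_nhds_zero_nat (𝕜 := ℝ))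
    refine this.congr (fun n => ?_)
    push_cast; ring
  have hy_lim : Tendsto y atTop (𝓝 (1 / 2)) := by
    rw [show (1 / 2 : ℝ) = 1 / 2 + 0 by ring]
    exact tendsto_const_nhds.add hlim0
  have hT : ∀ n, ex73Map (y n) = 1 / 2 := by
    intro n
    have : 0 < 1 / ((n : ℝ) + 2) := by positivity
    simp only [ex73Map, hy]
    rw [if_neg (by linarith)]
  have hε : Tendsto (fun n => dist (y (n + 1)) (ex73Map (y n))) atTop (𝓝 0) := by
    have e : ∀ n, dist (y (n + 1)) (ex73Map (y n)) = 1 / (((n + 1 : ℕ) : ℝ) + 2) := by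
      intro n
      rw [hT, Real.dist_eq]
      simp only [hy]
      rw [add_sub_cancel_left, abs_of_pos (by positivity)]
    simp_rw [e]
    exact (tendsto_add_atTop_iff_nat 1).2 hlim0
  have := tendsto_nhds_unique ((h y).1 hε) hy_lim
  norm_num at this

/-- **Remark 3) of §7.1, simplest instance**: for the nonexpansive map `T x = −x` of `ℝ` (unique
fixed point `0`) the Picard iteration is not `T`-stable: `y_n = (−1)^n` has `ε_n = 0` and
diverges. [cite: Berinde2007, Ch. 7 §7.1, Remark 3)] -/
theorem neg_not_isTStable : ¬ IsTStable (fun _ => fun x : ℝ => -x) 0 := by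
  intro h
  set y : ℕ → ℝ := fun n => (-1) ^ n with hy
  have hε : Tendsto (fun n => dist (y (n + 1)) (-(y n))) atTop (𝓝 0) := by
    refine tendsto_const_nhds.congr (fun n => ?_)
    simp [hy, pow_succ]
  have hlim := (h y).1 hε
  have heven : Tendsto (fun m => y (2 * m)) atTop (𝓝 0) :=
    hlim.comp (tendsto_atTop_mono (fun m : ℕ => (by omega : m ≤ 2 * m)) tendsto_id)
  have : Tendsto (fun m : ℕ => (1 : ℝ)) atTop (𝓝 0) := by
    refine heven.congr (fun m => ?_)
    simp [hy, pow_mul]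
  have := tendsto_nhds_unique this tendsto_const_nhds
  norm_num at this

end Examples

end Literature.Analysis.Convex.IterationStability
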